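import Summits.QuantumFields.QCD.Theorems.QuarksNoInfraredClauseThinQCDStubDiagonalExtractionT
import Summits.QuantumFields.QCD.Theorems.QuarksNoInfraredClauseThinQCDReindexTransport
import Literature.MathematicalPhysics.QuantumFieldTheory.QCDCalibratedSpeciesReindex
import HarnessLib

/-!
# Diagonal extraction for a calibrated family, RE-TYPED: per-tuple tightness + tensor mass-Lipschitz ⇒ a live, convergent reindexed family

Helper file offered to crux `ChiralCalibratedConvergence` (item stmt-QuantumFields-18044, route `CounterexampleMustBeHot`) by the
lead of its consumer `ThinQCD` (stmt-QuantumFields-17278, line `registered`, skeleton r6).  18044's registered "soft half" B2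
`stub_diagonalExtraction` is typed `Live 𝒞 → TightGlobal 𝒞 → MassLipschitz 𝒞 → ∃ ψ 𝒞₁, ∀ m>0, Bites 𝒞₁ m ∧ Kappa3 𝒞₁ m ∧
Converges 𝒞₁ m` with `TightGlobal` in TENSOR currency; a bound on off-diagonal REAL TENSORS does not control their span, so the
ε/3 step of the extraction cannot be run from it without an (unassembled) off-diagonal kernel theorem with bounds
(`Cruxes/ThinQCD/RESHAPE-r6.md` §(Q′)).  The extraction needs far less: this file proves

  `diagonalExtraction_of_perTuple`:  Live 𝒞 → MassLipschitz 𝒞 → (∀ m>0, T(m)) →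
      ∃ ψ (StrictMono) (𝒞₁ := 𝒞.reindex ψ over reg.restrict ψ), ∀ m>0, Bites 𝒞₁ m ∧ Kappa3 𝒞₁ m ∧ Converges 𝒞₁ m,

where `T(m)` is the PER-TUPLE ⁰𝒮-tightness `∃ s α β, ∀ n σ, ∀ᶠ k, ∀ F ∈ ⁰𝒮, ‖qcdLatticeDist (𝒞.scheme m) k n σ F‖ ≤ α (n!)^β ‖F‖_{n s}`
— the T-half of the per-tuple deliverable (T ∧ COMP) that the certified re-type 18044′ (`Cruxes/ConvergentOSClosure/Retype-signatures.md`
§3) emits anyway — and `Live`, `Bites`, `Kappa3`, `Converges`, `MassLipschitz` are the §0 abbreviations of 18044's skeleton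
`Cruxes/ChiralContinuumComplement/Lines/chiral_calibrated_convergence.lean` UNFOLDED VERBATIM (they live in a Cruxes file).  So B2
re-typed with `TightGlobal ↦ (∀ m>0, T(m))` is closed by this theorem.

Proof: the landed DE″ `stub_diagonalExtractionT` (p172524) gives `ψ` with convergence of every canonical lattice distribution on
⁰𝒮; the reindexed family `𝒞.reindex ψ` (Literature `QCDCalibratedSpeciesReindex`, p167857) has the reindexed lattice functions
definitionally, so biting calibrations and the `κ₃`-witness ride along (`R5.twoPoint_glue_reindex`, `R5.twoPoint_pseudoRe_reindex`,
`R5.kappa3_reindex`, p168244) and tensor convergence is distribution convergence read through `qcdLatticeSchwinger_eq_qcdLatticeDist`.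
No definition, no named fact, no `sorry`.
-/

noncomputable section

namespace Summit.QuantumFields.QCD.Theorems.ThinQCD

open scoped Topology SchwartzMap
open Filter
open Literature.MathematicalPhysics.QuantumFieldTheory Literature.MathematicalPhysics.QuantumLattice
  Literature.MathematicalPhysics.AQFT
open Summit.QuantumFields.QCD.Cruxes.StableActionBridge.Sketch (qcdLatticeDist qcdLatticeSchwinger_eq_qcdLatticeDist)
open Summit.QuantumFields.QCD.Theorems.ThinQCD.R5 (twoPoint_glue_reindex twoPoint_pseudoRe_reindex kappa3_reindex)

/-- **Diagonal extraction, re-typed for 18044's B2**: for ANY calibrated family over ANY regularisation, liveness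
(biting calibrations and the glue `κ₃`-witness at every positive tuple), the TENSOR-currency mass-Lipschitz modulus and
PER-TUPLE ⁰𝒮-tightness give a strictly increasing `ψ` such that the reindexed family `𝒞.reindex ψ` over `reg.restrict ψ` is
live and ALL its lattice `n`-point functions (`n ≠ 0`, off-diagonal real tensors) converge, at every positive tuple.
Hypotheses 1, 2 and the conclusion are `Live 𝒞`, `MassLipschitz 𝒞`, `Bites 𝒞₁ m ∧ Kappa3 𝒞₁ m ∧ Converges 𝒞₁ m` of 18044's
skeleton unfolded verbatim. [folklore] -/
theorem diagonalExtraction_of_perTuple :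
    ∀ (Nf : ℕ) (reg : QCDRegularisation Nf) (𝒞 : CalibratedSpeciesFamily reg),
    (∀ m : Fin Nf → ℝ, (∀ f, 0 < m f) →
      ((∀ᶠ k in Filter.atTop, (𝒞.scheme m).twoPoint k QCDField.glue QCDField.glue (thetaTest 4 𝒞.f₀) 𝒞.f₀ = 1) ∧
        (∀ f g : Fin Nf, f ≠ g → ∀ᶠ k in Filter.atTop,
          (𝒞.scheme m).twoPoint k (QCDField.pseudoRe f g) (QCDField.pseudoRe f g) (thetaTest 4 𝒞.f₀) 𝒞.f₀ = 1)) ∧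
      (∃ f g h : SchwartzMap (EuclideanSpace ℝ (Fin 4)) ℝ, tsupport (f : EuclideanSpace ℝ (Fin 4) → ℝ) ⊆ {x | x 0 < 0} ∧
        tsupport (g : EuclideanSpace ℝ (Fin 4) → ℝ) ⊆ {x | 0 < x 0 ∧ x 0 < 1} ∧
        tsupport (h : EuclideanSpace ℝ (Fin 4) → ℝ) ⊆ {x | 1 < x 0} ∧ ∃ ε > (0 : ℝ), ∀ᶠ k in Filter.atTop,
          ε ≤ ‖qcdLatticeSchwinger (𝒞.scheme m) k 3 ![QCDField.glue, QCDField.glue, QCDField.glue] ![f, g, h] -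
            qcdLatticeSchwinger (𝒞.scheme m) k 1 ![QCDField.glue] ![f] *
              qcdLatticeSchwinger (𝒞.scheme m) k 2 ![QCDField.glue, QCDField.glue] ![g, h] -
            qcdLatticeSchwinger (𝒞.scheme m) k 1 ![QCDField.glue] ![g] *
              qcdLatticeSchwinger (𝒞.scheme m) k 2 ![QCDField.glue, QCDField.glue] ![f, h] -
            qcdLatticeSchwinger (𝒞.scheme m) k 1 ![QCDField.glue] ![h] *
              qcdLatticeSchwinger (𝒞.scheme m) k 2 ![QCDField.glue, QCDField.glue] ![f, g] +
            2 * (qcdLatticeSchwinger (𝒞.scheme m) k 1 ![QCDField.glue] ![f] *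
              qcdLatticeSchwinger (𝒞.scheme m) k 1 ![QCDField.glue] ![g] *
              qcdLatticeSchwinger (𝒞.scheme m) k 1 ![QCDField.glue] ![h])‖)) →
    (∀ n : ℕ, n ≠ 0 → ∀ (σ : Fin n → QCDField Nf) (f : Fin n → SchwartzMap (EuclideanSpace ℝ (Fin 4)) ℝ)
      (F : SchwartzMap (Fin n → EuclideanSpace ℝ (Fin 4)) ℂ), IsTensorOf F (fun i => ofRealTest (f i)) →
        IsOffDiagonal F → ∀ R : ℝ, (∀ i, tsupport (f i) ⊆ Metric.closedBall 0 R) →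
          ∀ K : Set (Fin Nf → ℝ), IsCompact K → K ⊆ {m | ∀ fl, 0 < m fl} →
            ∃ C : ℝ, ∀ᶠ k in Filter.atTop, ∀ m ∈ K, ∀ m' ∈ K,
              ‖qcdLatticeSchwinger (𝒞.scheme m) k n σ f - qcdLatticeSchwinger (𝒞.scheme m') k n σ f‖ ≤ C * ‖m - m'‖) →
    (∀ m : Fin Nf → ℝ, (∀ f, 0 < m f) →
      ∃ (s : ℕ) (α β : ℝ), ∀ (n : ℕ) (σ : Fin n → QCDField Nf), ∀ᶠ k in Filter.atTop,
        ∀ F : SchwartzMap (Fin n → EuclideanSpace ℝ (Fin 4)) ℂ, IsOffDiagonal F →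
          ‖qcdLatticeDist (𝒞.scheme m) k n σ F‖ ≤ α * (n.factorial : ℝ) ^ β * schwartzNorm (n * s) F) →
    ∃ (ψ : ℕ → ℕ) (hψ : StrictMono ψ) (𝒞₁ : CalibratedSpeciesFamily (reg.restrict ψ hψ.tendsto_atTop)),
      ∀ m : Fin Nf → ℝ, (∀ f, 0 < m f) →
        ((∀ᶠ k in Filter.atTop, (𝒞₁.scheme m).twoPoint k QCDField.glue QCDField.glue (thetaTest 4 𝒞₁.f₀) 𝒞₁.f₀ = 1) ∧
          (∀ f g : Fin Nf, f ≠ g → ∀ᶠ k in Filter.atTop,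
            (𝒞₁.scheme m).twoPoint k (QCDField.pseudoRe f g) (QCDField.pseudoRe f g) (thetaTest 4 𝒞₁.f₀) 𝒞₁.f₀ = 1)) ∧
        (∃ f g h : SchwartzMap (EuclideanSpace ℝ (Fin 4)) ℝ, tsupport (f : EuclideanSpace ℝ (Fin 4) → ℝ) ⊆ {x | x 0 < 0} ∧
          tsupport (g : EuclideanSpace ℝ (Fin 4) → ℝ) ⊆ {x | 0 < x 0 ∧ x 0 < 1} ∧
          tsupport (h : EuclideanSpace ℝ (Fin 4) → ℝ) ⊆ {x | 1 < x 0} ∧ ∃ ε > (0 : ℝ), ∀ᶠ k in Filter.atTop,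
            ε ≤ ‖qcdLatticeSchwinger (𝒞₁.scheme m) k 3 ![QCDField.glue, QCDField.glue, QCDField.glue] ![f, g, h] -
              qcdLatticeSchwinger (𝒞₁.scheme m) k 1 ![QCDField.glue] ![f] *
                qcdLatticeSchwinger (𝒞₁.scheme m) k 2 ![QCDField.glue, QCDField.glue] ![g, h] -
              qcdLatticeSchwinger (𝒞₁.scheme m) k 1 ![QCDField.glue] ![g] *
                qcdLatticeSchwinger (𝒞₁.scheme m) k 2 ![QCDField.glue, QCDField.glue] ![f, h] -
              qcdLatticeSchwinger (𝒞₁.scheme m) k 1 ![QCDField.glue] ![h] *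
                qcdLatticeSchwinger (𝒞₁.scheme m) k 2 ![QCDField.glue, QCDField.glue] ![f, g] +
              2 * (qcdLatticeSchwinger (𝒞₁.scheme m) k 1 ![QCDField.glue] ![f] *
                qcdLatticeSchwinger (𝒞₁.scheme m) k 1 ![QCDField.glue] ![g] *
                qcdLatticeSchwinger (𝒞₁.scheme m) k 1 ![QCDField.glue] ![h])‖) ∧
        (∀ n : ℕ, n ≠ 0 → ∀ (σ : Fin n → QCDField Nf) (f : Fin n → SchwartzMap (EuclideanSpace ℝ (Fin 4)) ℝ)
          (F : SchwartzMap (Fin n → EuclideanSpace ℝ (Fin 4)) ℂ), IsTensorOf F (fun i => ofRealTest (f i)) →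
            IsOffDiagonal F → ∃ c : ℂ, Filter.Tendsto (fun k : ℕ => qcdLatticeSchwinger (𝒞₁.scheme m) k n σ f)
              Filter.atTop (nhds c)) := by
  intro Nf reg 𝒞 hLive hLip hT
  obtain ⟨ψ, hψ, hconv⟩ := stub_diagonalExtractionT Nf reg 𝒞 hT hLip
  have hψt : Tendsto ψ atTop atTop := hψ.tendsto_atTop
  refine ⟨ψ, hψ, 𝒞.reindex ψ hψt, fun m hm => ?_⟩
  obtain ⟨⟨hb1, hb2⟩, hK3⟩ := hLive m hm
  refine ⟨⟨twoPoint_glue_reindex 𝒞 ψ hψt (𝒞.reindex ψ hψt) (fun _ _ _ => rfl) (fun _ _ _ => rfl) rfl hb1,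
      twoPoint_pseudoRe_reindex 𝒞 ψ hψt (𝒞.reindex ψ hψt) (fun _ _ _ => rfl) (fun _ _ _ => rfl) rfl hb2⟩,
    kappa3_reindex 𝒞 ψ hψt (𝒞.reindex ψ hψt) (fun _ _ _ => rfl) (fun _ _ _ => rfl) hK3, ?_⟩
  -- tensor convergence of the reindexed family = distribution convergence along `ψ`
  intro n hn σ f F hF hoff
  obtain ⟨c, hc⟩ := hconv m hm n σ F hoff
  refine ⟨c, ?_⟩
  have hfun : (fun k : ℕ => qcdLatticeSchwinger ((𝒞.reindex ψ hψt).scheme m) k n σ f) =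
      fun k : ℕ => qcdLatticeDist (𝒞.scheme m) (ψ k) n σ F := by
    funext k
    rw [CalibratedSpeciesFamily.qcdLatticeSchwinger_reindex, ← qcdLatticeSchwinger_eq_qcdLatticeDist _ _ _ hn σ f F hF]
  rw [hfun]
  exact hc

end Summit.QuantumFields.QCD.Theorems.ThinQCD

end
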